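import Summits.AtomisticToContinuum.HydrodynamicLimit.Theses.LambertianContactSwap
import Summits.AtomisticToContinuum.HydrodynamicLimit.Theses.JaynesSqueeze

/-!
# Sketch — crux idea `iprojection-short-window-dock` for stmt-AtomisticToContinuum-12097
(`LambertianContactSwap.ContactAngleEquidistribution`), crux-ideate round 2, ideator 5.

First-lemma typing only (no proofs). Everything is stated over the crux's own Alexander
`let`-block. Declarations:

* `ShortWindowAngularPressure`  (S1)  — LLN-scale pressure bound for the ACTIVITY-CLAMPED centred
  angular functional over a window of `τ (N+1)^{-1/3}` (a fraction `τ ≤ τ₀(σ)` of a mean free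
  time) under a BLOCK-CONSTANT local Gibbs reference: `log ∫ exp(l X) dQ ≤ (N+1)(C l² + η|l|)`.
* `AngularActivityTails`        (S3)  — uniform integrability, under the TRUE evolved law, of the
  `|g|²`-mass of collisions whose partners have window activity `> V`.
* `ContactAngleEquidistributionInBand` — the crux's conclusion under the quantifier prefix of
  `JaynesSqueeze.BlockGibbs` (Euler solution on `[0,T)`, `t = 0` LLN hypothesis, packing guard,
  `t < T`): what the route's consumer `SwapGap` actually quantifies over.
* `Dock` — the implication shape `BlockGibbs → S1 → S3 → ContactAngleEquidistributionInBand`.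
* `NearConstantProfiles` — the all-times milestone: the crux along profile sequences converging
  uniformly to constants (reference = the invariant homogeneous Gibbs law, no entropy input).
* `DockNearConstant` — `S1 → AngularActivityTailsNC → NearConstantProfiles`.
-/

namespace Summit.AtomisticToContinuum.HydrodynamicLimit.Cruxes.ContactAngleEquidistribution.IProjectionWindowDock

open scoped Classical
open MeasureTheory Filter Set
open Literature.Analysis.FluidPDE Literature.MathematicalPhysics.KineticTheory

/-- **S1 `ShortWindowAngularPressure`.** For block-constant local Gibbs references `Q` with
parameters in a compact range, windows `w = τ (N+1)^{-1/3}` with `τ ≤ τ₀(σ)` (sub-Lanford,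
subcritical space–time cluster regime at fixed reduced density `σ³ < σ₀³`), activity level `V`,
admissible marks `ψ_N`, and tilts `|l| ≤ l₀`: the clamped centred angular window functional
`X = Σ_{coll m in [0,w]} 1{act_i ≤ V} 1{act_j ≤ V} |g|² (ψ − κ_g ψ)` (activity
`act_i = Σ_{coll of i in the window} (1 + |g|²)`, so `|X| ≤ 2V(N+1)` pathwise) satisfies
`∫ exp(l X) dQ ≤ exp((N+1)(C l² + η |l|))` eventually in `N`, uniformly over the block data —
an LLN-scale (speed `N+1`) pressure bound; `η` = clamp-induced centring defect, `→ 0` as `V → ∞`.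
Expected proof: BGSS-type dynamical cluster expansion over a fraction of a mean free time
(arXiv:2205.04110 Prop. 2.6) transplanted to fixed small `σ` + canonical statics + the landed
equilibrium centring (`eq_contactAngleEquidistribution_const`). -/
def ShortWindowAngularPressure : Prop :=
  let Cfg : ℕ → Type := fun N => Config (N + 1) (Fin 3) T3
  let G := Literature.Analysis.FluidPDE.Torus.geometry (Fin 3)
  let ε : ℝ → ℕ → ℝ := hsDiameter
  let τf : ℝ → (N : ℕ) → Cfg N → ENNReal := fun σ N z => Alexander.freeExitTime G (ε σ N) z
  let S : ℝ → (N : ℕ) → Cfg N → Cfg N := fun t _ z => freeFlight G t z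
  let ldir : V3 → V3 → V3 := fun ω ξ => ‖‖ω‖⁻¹ • ω + ‖ξ‖⁻¹ • ξ‖⁻¹ • (‖ω‖⁻¹ • ω + ‖ξ‖⁻¹ • ξ)
  let zpre : ℝ → (N : ℕ) → Cfg N → ℕ → Cfg N := fun σ N z m =>
    let y := Alexander.stateAfter G (ε σ N) z m; S (τf σ N y).toReal N y
  let Kt : ℝ → (N : ℕ) → Cfg N → ℝ → ℕ := fun σ N z t => Alexander.collisionCount G (ε σ N) z t
  let hit : ℝ → (N : ℕ) → Cfg N → Fin (N + 1) → Fin (N + 1) → Prop := fun σ N y i j =>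
    i < j ∧ y ∈ contactSet G (N + 1) (ε σ N) i j ∧ IsIncoming G y i j
  let tcol : ℝ → (N : ℕ) → Cfg N → ℕ → ℝ := fun σ N z m =>
    (Alexander.collisionInstant G (ε σ N) z (m + 1)).toReal
  let xmid : (N : ℕ) → Cfg N → Fin (N + 1) → Fin (N + 1) → T3 := fun _ y i j =>
    G.translate (y j).1 ((2 : ℝ)⁻¹ • G.sepVec (y i).1 (y j).1)
  let act : ℝ → (N : ℕ) → Cfg N → ℕ → Fin (N + 1) → ℝ := fun σ N z K i =>
    ∑ m ∈ Finset.range K, ∑ j : Fin (N + 1),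
      (let y := zpre σ N z m
       if hit σ N y i j ∨ hit σ N y j i then 1 + ‖(y i).2 - (y j).2‖ ^ 2 else 0)
  let X : ℝ → (N : ℕ) → ℝ → ℝ → (ℝ → T3 → V3 → V3 → V3 → ℝ) → Cfg N → ℝ := fun σ N w V ψ z =>
    ∑ m ∈ Finset.range (Kt σ N z w), ∑ i : Fin (N + 1), ∑ j : Fin (N + 1),
      (let y := zpre σ N z m
       if hit σ N y i j then
         (if act σ N z (Kt σ N z w) i ≤ V ∧ act σ N z (Kt σ N z w) j ≤ V then
            ‖(y i).2 - (y j).2‖ ^ 2 *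
              (ψ (tcol σ N z m) (xmid N y i j) (y i).2 (y j).2
                  ((ε σ N)⁻¹ • G.sepVec (y i).1 (y j).1) -
                ∫ ξ, ψ (tcol σ N z m) (xmid N y i j) (y i).2 (y j).2 (ldir (-((y i).2 - (y j).2)) ξ)
                  ∂(ProbabilityTheory.stdGaussian V3))
          else 0)
       else 0)
  let idx : ℕ → T3 → (Fin 3 → ℕ) := fun mb x i =>
    ⌊(mb : ℝ) * Literature.Analysis.FunctionSpaces.Torus.repr x i⌋₊
  ∀ A Θ Ub : ℝ, 0 < A → 0 < Θ → ∃ σ₀ : ℝ, 0 < σ₀ ∧ ∀ σ : ℝ, 0 < σ → σ < σ₀ →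
    ∀ Φ : (N : ℕ) → HardSphereFlow G (ε σ N) (N + 1),
    ∃ τ₀ : ℝ, 0 < τ₀ ∧ ∀ τ : ℝ, 0 < τ → τ ≤ τ₀ → ∀ η : ℝ, 0 < η →
      ∃ V₀ : ℝ, 0 < V₀ ∧ ∀ V : ℝ, V₀ ≤ V → ∃ C l₀ : ℝ, 0 < l₀ ∧ ∀ mb : ℕ,
        ∀ ψ : ℕ → ℝ → T3 → V3 → V3 → V3 → ℝ,
          (∀ N, Measurable (fun p : ℝ × T3 × V3 × V3 × V3 =>
            ψ N p.1 p.2.1 p.2.2.1 p.2.2.2.1 p.2.2.2.2)) →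
          (∀ N s x v w n, |ψ N s x v w n| ≤ 1) →
          (∀ N s x v w (n n' : V3), ‖n‖ = 1 → ‖n'‖ = 1 →
            |ψ N s x v w n - ψ N s x v w n'| ≤ ‖n - n'‖) →
          ∀ᶠ N : ℕ in atTop, ∀ (ca cθ : (Fin 3 → ℕ) → ℝ) (cu : (Fin 3 → ℕ) → V3),
            (∀ k, A⁻¹ ≤ ca k ∧ ca k ≤ A ∧ Θ⁻¹ ≤ cθ k ∧ cθ k ≤ Θ ∧ ‖cu k‖ ≤ Ub) →
            ∀ l : ℝ, |l| ≤ l₀ →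
              let Q := localGibbsLaw σ (fun x => ca (idx mb x)) (fun x => cu (idx mb x))
                (fun x => cθ (idx mb x)) N (Φ N)
              let w : ℝ := τ * ((N : ℝ) + 1) ^ (-(1 / 3 : ℝ))
              ∫⁻ z, ENNReal.ofReal (Real.exp (l * X σ N w V (ψ N) z)) ∂Q ≤
                ENNReal.ofReal (Real.exp (((N : ℝ) + 1) * (C * l ^ 2 + η * |l|)))

/-- **S3 `AngularActivityTails`.** Under the TRUE deterministically evolved local Gibbs law,
before the first shock and in the dilute band (the prefix of `JaynesSqueeze.BlockGibbs`), the
normalised `|g|²`-mass of collisions one of whose partners has window activity `> V` (windows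
`[k w, (k+1) w)`, `w = τ (N+1)^{-1/3}`) is uniformly small: `∀ τ ∀ η ∃ V₀ ∀ V ≥ V₀`, eventually in
`N`, `(N+1)^{-4/3} E_{P_N} Σ_{coll ≤ t} |g|² 1{act_i > V ∨ act_j > V} ≤ η`. A-priori
(12102 / stmt-13734 `TransferActivityTails` family): UI of the collision activity, not chaos. -/
def AngularActivityTails : Prop :=
  let Cfg : ℕ → Type := fun N => Config (N + 1) (Fin 3) T3
  let G := Literature.Analysis.FluidPDE.Torus.geometry (Fin 3)
  let ε : ℝ → ℕ → ℝ := hsDiameter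
  let τf : ℝ → (N : ℕ) → Cfg N → ENNReal := fun σ N z => Alexander.freeExitTime G (ε σ N) z
  let S : ℝ → (N : ℕ) → Cfg N → Cfg N := fun t _ z => freeFlight G t z
  let zpre : ℝ → (N : ℕ) → Cfg N → ℕ → Cfg N := fun σ N z m =>
    let y := Alexander.stateAfter G (ε σ N) z m; S (τf σ N y).toReal N y
  let Kt : ℝ → (N : ℕ) → Cfg N → ℝ → ℕ := fun σ N z t => Alexander.collisionCount G (ε σ N) z t
  let hit : ℝ → (N : ℕ) → Cfg N → Fin (N + 1) → Fin (N + 1) → Prop := fun σ N y i j =>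
    i < j ∧ y ∈ contactSet G (N + 1) (ε σ N) i j ∧ IsIncoming G y i j
  let tcol : ℝ → (N : ℕ) → Cfg N → ℕ → ℝ := fun σ N z m =>
    (Alexander.collisionInstant G (ε σ N) z (m + 1)).toReal
  -- activity of particle `i` over the collisions of the `k`-th window `[k w, (k+1) w)`
  let actW : ℝ → (N : ℕ) → Cfg N → ℝ → ℕ → Fin (N + 1) → ℝ := fun σ N z w k i =>
    ∑ m ∈ Finset.Ico (Kt σ N z (k * w)) (Kt σ N z ((k + 1) * w)), ∑ j : Fin (N + 1),
      (let y := zpre σ N z m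
       if hit σ N y i j ∨ hit σ N y j i then 1 + ‖(y i).2 - (y j).2‖ ^ 2 else 0)
  let kidx : ℝ → (N : ℕ) → Cfg N → ℝ → ℕ → ℕ := fun σ N z w m => ⌊tcol σ N z m / w⌋₊
  ∀ (a₀ θ₀ : T3 → ℝ) (u₀ : T3 → V3), Continuous a₀ → Continuous θ₀ → Continuous u₀ →
    (∀ x, 0 < a₀ x) → (∀ x, 0 < θ₀ x) →
    ∃ σ₀ : ℝ, 0 < σ₀ ∧ ∃ ηc : ℝ, 0 < ηc ∧ ∀ σ : ℝ, 0 < σ → σ < σ₀ →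
      ∀ (T : ℝ) (ρ θ : ℝ → T3 → ℝ) (u : ℝ → T3 → V3), IsHardSphereEulerSolution σ T ρ u θ →
      ∀ Φ : (N : ℕ) → HardSphereFlow G (ε σ N) (N + 1),
        let P := fun N => localGibbsLaw σ a₀ u₀ θ₀ N (Φ N)
        TendstoHydroFieldsAt P Φ ρ u θ 0 → ∀ t ∈ Set.Ico 0 T,
          (∀ s ∈ Set.Icc 0 t, ∀ x, ρ s x * σ ^ 3 ≤ ηc) →
          ∀ τ : ℝ, 0 < τ → ∀ η : ℝ, 0 < η → ∃ V₀ : ℝ, 0 < V₀ ∧ ∀ V : ℝ, V₀ ≤ V →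
            ∀ᶠ N : ℕ in atTop,
              let w : ℝ := τ * ((N : ℝ) + 1) ^ (-(1 / 3 : ℝ))
              ∫ z, ((N : ℝ) + 1) ^ (-(4 / 3 : ℝ)) *
                  ∑ m ∈ Finset.range (Kt σ N z t), ∑ i : Fin (N + 1), ∑ j : Fin (N + 1),
                    (let y := zpre σ N z m
                     if hit σ N y i j then
                       (if V < actW σ N z w (kidx σ N z w m) i ∨ V < actW σ N z w (kidx σ N z w m) j
                        then ‖(y i).2 - (y j).2‖ ^ 2 else 0)
                     else 0) ∂(P N) ≤ η

/-- **The docked conclusion.** The crux's conclusion (`ContactAngleEquidistribution`, verbatim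
functional) under the quantifier prefix of `JaynesSqueeze.BlockGibbs` / of the route's consumer
`SwapGap`: classical hs-Euler solution on `[0,T)`, the conjunct's `t = 0` LLN hypothesis, packing
guard on `[0,t]`, `t < T`. This is the part of 12097 the route consumes; 12097 as filed
(`∀ t ≥ 0`, all continuous profiles, no guard) is strictly stronger. -/
def ContactAngleEquidistributionInBand : Prop :=
  let Cfg : ℕ → Type := fun N => Config (N + 1) (Fin 3) T3
  let G := Literature.Analysis.FluidPDE.Torus.geometry (Fin 3)
  let ε : ℝ → ℕ → ℝ := hsDiameter
  let τf : ℝ → (N : ℕ) → Cfg N → ENNReal := fun σ N z => Alexander.freeExitTime G (ε σ N) z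
  let S : ℝ → (N : ℕ) → Cfg N → Cfg N := fun t _ z => freeFlight G t z
  let ldir : V3 → V3 → V3 := fun ω ξ => ‖‖ω‖⁻¹ • ω + ‖ξ‖⁻¹ • ξ‖⁻¹ • (‖ω‖⁻¹ • ω + ‖ξ‖⁻¹ • ξ)
  let zpre : ℝ → (N : ℕ) → Cfg N → ℕ → Cfg N := fun σ N z m =>
    let y := Alexander.stateAfter G (ε σ N) z m; S (τf σ N y).toReal N y
  let Kt : ℝ → (N : ℕ) → Cfg N → ℝ → ℕ := fun σ N z t => Alexander.collisionCount G (ε σ N) z t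
  let hit : ℝ → (N : ℕ) → Cfg N → Fin (N + 1) → Fin (N + 1) → Prop := fun σ N y i j =>
    i < j ∧ y ∈ contactSet G (N + 1) (ε σ N) i j ∧ IsIncoming G y i j
  let tcol : ℝ → (N : ℕ) → Cfg N → ℕ → ℝ := fun σ N z m =>
    (Alexander.collisionInstant G (ε σ N) z (m + 1)).toReal
  let xmid : (N : ℕ) → Cfg N → Fin (N + 1) → Fin (N + 1) → T3 := fun _ y i j =>
    G.translate (y j).1 ((2 : ℝ)⁻¹ • G.sepVec (y i).1 (y j).1)
  ∀ (a₀ θ₀ : T3 → ℝ) (u₀ : T3 → V3), Continuous a₀ → Continuous θ₀ → Continuous u₀ →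
    (∀ x, 0 < a₀ x) → (∀ x, 0 < θ₀ x) →
    ∃ σ₀ : ℝ, 0 < σ₀ ∧ ∃ ηc : ℝ, 0 < ηc ∧ ∀ σ : ℝ, 0 < σ → σ < σ₀ →
      ∀ (T : ℝ) (ρ θ : ℝ → T3 → ℝ) (u : ℝ → T3 → V3), IsHardSphereEulerSolution σ T ρ u θ →
      ∀ Φ : (N : ℕ) → HardSphereFlow G (ε σ N) (N + 1),
        let P := fun N => localGibbsLaw σ a₀ u₀ θ₀ N (Φ N)
        TendstoHydroFieldsAt P Φ ρ u θ 0 → ∀ t ∈ Set.Ico 0 T,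
          (∀ s ∈ Set.Icc 0 t, ∀ x, ρ s x * σ ^ 3 ≤ ηc) →
          ∀ ψ : ℕ → ℝ → T3 → V3 → V3 → V3 → ℝ,
            (∀ N, Measurable (fun p : ℝ × T3 × V3 × V3 × V3 =>
              ψ N p.1 p.2.1 p.2.2.1 p.2.2.2.1 p.2.2.2.2)) →
            (∀ N s x v w n, |ψ N s x v w n| ≤ 1) →
            (∀ N s x v w (n n' : V3), ‖n‖ = 1 → ‖n'‖ = 1 →
              |ψ N s x v w n - ψ N s x v w n'| ≤ ‖n - n'‖) →
            Tendsto (fun N : ℕ => ∫ z, ((N : ℝ) + 1) ^ (-(4 / 3 : ℝ)) *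
              ∑ m ∈ Finset.range (Kt σ N z t), ∑ i : Fin (N + 1), ∑ j : Fin (N + 1),
                (let y := zpre σ N z m
                 if hit σ N y i j then
                   ‖(y i).2 - (y j).2‖ ^ 2 *
                     (ψ N (tcol σ N z m) (xmid N y i j) (y i).2 (y j).2
                         ((ε σ N)⁻¹ • G.sepVec (y i).1 (y j).1) -
                       ∫ ξ, ψ N (tcol σ N z m) (xmid N y i j) (y i).2 (y j).2
                         (ldir (-((y i).2 - (y j).2)) ξ) ∂(ProbabilityTheory.stdGaussian V3))
                 else 0) ∂(P N)) atTop (nhds 0)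

/-- **Dock shape.** Yau's block local Gibbsianity (the shared typed waypoint of route
JaynesSqueeze, stmt-13462; ⟸ `NoMeanEntropyProduction` by the LANDED `squeezeToBlockGibbs_proof`,
⟸ `RelEntropyVanishing` 0766 up to uniformity in `s`) + S1 + S3 ⇒ the in-band crux. Glue
(provable now): restart of Alexander's construction at the window grid, the proved transfer
`|∫X dμ| ≤ B/θ + θ v` (KL budget `B = δ(N+1)`, S1 MGF), summation over `t(N+1)^{1/3}/τ` windows:
`(N+1)^{-4/3} Σ_w |E X_w| ≤ (2t/τ)(√(C δ) + η) → 0`, then S3 for the clamped-out mass. -/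
def Dock : Prop :=
  Summit.AtomisticToContinuum.HydrodynamicLimit.Theses.JaynesSqueeze.BlockGibbs →
    ShortWindowAngularPressure → AngularActivityTails → ContactAngleEquidistributionInBand

/-- **All-times milestone `NearConstantProfiles`.** The crux's conclusion, for ALL `t ≥ 0`, along
profile SEQUENCES `(a_N, u_N, θ_N)` converging uniformly to constants `(ā, ū, θ̄)` (any rate):
strictly between the landed constant-profile theorem `eq_contactAngleEquidistribution_const`
(p132196) and the crux. Reference = the INVARIANT homogeneous Gibbs law, budget
`H(P_N ‖ G_N) = O(d_N²)(N+1) = o(N+1)` conserved in time, so no entropy input and no pre-shock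
restriction: `NearConstantProfiles ⟸ S1 ∧ (activity tails)`. -/
def NearConstantProfiles : Prop :=
  let Cfg : ℕ → Type := fun N => Config (N + 1) (Fin 3) T3
  let G := Literature.Analysis.FluidPDE.Torus.geometry (Fin 3)
  let ε : ℝ → ℕ → ℝ := hsDiameter
  let τf : ℝ → (N : ℕ) → Cfg N → ENNReal := fun σ N z => Alexander.freeExitTime G (ε σ N) z
  let S : ℝ → (N : ℕ) → Cfg N → Cfg N := fun t _ z => freeFlight G t z
  let ldir : V3 → V3 → V3 := fun ω ξ => ‖‖ω‖⁻¹ • ω + ‖ξ‖⁻¹ • ξ‖⁻¹ • (‖ω‖⁻¹ • ω + ‖ξ‖⁻¹ • ξ)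
  let zpre : ℝ → (N : ℕ) → Cfg N → ℕ → Cfg N := fun σ N z m =>
    let y := Alexander.stateAfter G (ε σ N) z m; S (τf σ N y).toReal N y
  let Kt : ℝ → (N : ℕ) → Cfg N → ℝ → ℕ := fun σ N z t => Alexander.collisionCount G (ε σ N) z t
  let hit : ℝ → (N : ℕ) → Cfg N → Fin (N + 1) → Fin (N + 1) → Prop := fun σ N y i j =>
    i < j ∧ y ∈ contactSet G (N + 1) (ε σ N) i j ∧ IsIncoming G y i j
  let tcol : ℝ → (N : ℕ) → Cfg N → ℕ → ℝ := fun σ N z m =>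
    (Alexander.collisionInstant G (ε σ N) z (m + 1)).toReal
  let xmid : (N : ℕ) → Cfg N → Fin (N + 1) → Fin (N + 1) → T3 := fun _ y i j =>
    G.translate (y j).1 ((2 : ℝ)⁻¹ • G.sepVec (y i).1 (y j).1)
  ∀ (abar thbar : ℝ) (ubar : V3), 0 < abar → 0 < thbar → ∃ σ₀ : ℝ, 0 < σ₀ ∧ ∀ σ : ℝ, 0 < σ → σ < σ₀ →
    ∀ Φ : (N : ℕ) → HardSphereFlow G (ε σ N) (N + 1),
    ∀ (aN θN : ℕ → T3 → ℝ) (uN : ℕ → T3 → V3) (d : ℕ → ℝ),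
      (∀ N, Continuous (aN N) ∧ Continuous (θN N) ∧ Continuous (uN N)) →
      (∀ N x, |aN N x - abar| ≤ d N ∧ |θN N x - thbar| ≤ d N ∧ ‖uN N x - ubar‖ ≤ d N) →
      Tendsto d atTop (nhds 0) →
      let P := fun N => localGibbsLaw σ (aN N) (uN N) (θN N) N (Φ N)
      ∀ t : ℝ, 0 ≤ t → ∀ ψ : ℕ → ℝ → T3 → V3 → V3 → V3 → ℝ,
        (∀ N, Measurable (fun p : ℝ × T3 × V3 × V3 × V3 =>
          ψ N p.1 p.2.1 p.2.2.1 p.2.2.2.1 p.2.2.2.2)) →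
        (∀ N s x v w n, |ψ N s x v w n| ≤ 1) →
        (∀ N s x v w (n n' : V3), ‖n‖ = 1 → ‖n'‖ = 1 →
          |ψ N s x v w n - ψ N s x v w n'| ≤ ‖n - n'‖) →
        Tendsto (fun N : ℕ => ∫ z, ((N : ℝ) + 1) ^ (-(4 / 3 : ℝ)) *
          ∑ m ∈ Finset.range (Kt σ N z t), ∑ i : Fin (N + 1), ∑ j : Fin (N + 1),
            (let y := zpre σ N z m
             if hit σ N y i j then
               ‖(y i).2 - (y j).2‖ ^ 2 *
                 (ψ N (tcol σ N z m) (xmid N y i j) (y i).2 (y j).2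
                     ((ε σ N)⁻¹ • G.sepVec (y i).1 (y j).1) -
                   ∫ ξ, ψ N (tcol σ N z m) (xmid N y i j) (y i).2 (y j).2
                     (ldir (-((y i).2 - (y j).2)) ξ) ∂(ProbabilityTheory.stdGaussian V3))
             else 0) ∂(P N)) atTop (nhds 0)

/-- **Sanity anchor (kernel-checked, trivial):** the in-band conclusion is implied by the crux as
filed — 12097 is at least as strong as what the route consumes. (Drops `T, ρ, u, θ`, the Euler
hypothesis, the `t = 0` hypothesis and the guard.) -/
theorem inBand_of_crux
    (h : Summit.AtomisticToContinuum.HydrodynamicLimit.Theses.LambertianContactSwap.ContactAngleEquidistribution) :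
    ContactAngleEquidistributionInBand := by
  intro a₀ θ₀ u₀ ha hθ hu hap hθp
  obtain ⟨σ₀, hσ₀, H⟩ := h a₀ θ₀ u₀ ha hθ hu hap hθp
  refine ⟨σ₀, hσ₀, 1, one_pos, ?_⟩
  intro σ hσ hσ' T ρ θ u hsol Φ P h0 t ht hguard ψ hψm hψb hψl
  exact H σ hσ hσ' Φ t ht.1 ψ hψm hψb hψl

end Summit.AtomisticToContinuum.HydrodynamicLimit.Cruxes.ContactAngleEquidistribution.IProjectionWindowDock
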